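import Summits.KontsevichZagierPeriods.KontsevichZagierPeriods.Theorems.LogPrimitiveNL.Negative.Rigidity
import Literature.NumberTheory.Transcendental.KZLogCalculusProofs
import Literature.NumberTheory.Transcendental.SemialgebraicDerivativeProofs

/-!
# Line `logderiv-peeling` for crux `LogPrimitiveNL` (stmt-KontsevichZagierPeriods-2836) — skeleton

Lead's skeleton (reshaped from the planner's registered 5-stub skeleton, shas 740ef8cf/1846be64,
into 7 stubs; composition unchanged):

* `stub_minNormalisation` (T1) — fibre-minimum `m` of `V` is `ℚ`-semialgebraic, `0 < m ≤ V`, and the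
  min-normalised endpoint monomials `h · log (V(·,ρ)/m)` (`ρ = a, b`) are integrable (Tonelli + FTC).
* `stub_transfer` (T2) — `MinNormalisation → Negative.BoundaryRigidity → crux` (tree engine
  `KZ.unfoldedLogStokes_mem_relations` with `H = hᵢ ∘ init`, `V = Vᵢ/mᵢ ≥ 1`, BR with `2k` monomials).
* `stub_coneDecomposition` — pure linear algebra: simplicial rational decomposition of the cone
  `ker F ∩ ℝ^k_{≥0}`.
* `stub_cellwiseFold` — `ConeDecomposition →` (registered `stub_cellwiseFold`): unrolling of the
  unfolded monomials on each cell with all intermediate representations admissible.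
* `stub_peelingStep`, `stub_constRigidity` — registered verbatim.
* `stub_descent` — registered verbatim (`PeelingStep → ConstRigidity → LogLinearDescent`), held by the lead.

Glue (sorry-free): `boundaryRigidity_of_stubs`, `LogPrimitiveNL_of` (concludes the crux BY NAME).
-/

noncomputable section

open Set MeasureTheory
open Literature.NumberTheory.Transcendental Literature.ModelTheory.ExponentialFields

namespace Summit.KontsevichZagierPeriods.LiouvilleUnfolding.LogPrimitiveNL

open Summit.KontsevichZagierPeriods.KontsevichZagierPeriods.Theses.LiouvilleUnfolding (LogPrimitiveNL)

/-! ## The stubs -/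

/-- **T1, min-normalisation.** Over a `ℚ`-semialgebraic base `τ` with edges `a ≤ b`, for `V > 0`
`ℚ`-semialgebraic on the closed band, continuous on closed fibres and differentiable on open fibres
with derivative `V'`, and `h` `ℚ`-semialgebraic on `τ` with `h V'/V` integrable on the band: the fibre
minimum `m x = min_{t ∈ [a x, b x]} V (x, t)` is `ℚ`-semialgebraic (Tarski–Seidenberg), `0 < m ≤ V`,
and both min-normalised endpoint monomials `h · log (V(·, b)/m)`, `h · log (V(·, a)/m)` are integrable
on `τ` (each is dominated by the fibre integral of `|h V'/V|`: FTC from the argmin, Tonelli). -/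
theorem stub_minNormalisation :
    ∀ (n : ℕ) (τ : Set (Fin n → ℝ)) (a b : (Fin n → ℝ) → ℝ) (h : (Fin n → ℝ) → ℝ)
      (V V' : (Fin (n + 1) → ℝ) → ℝ),
      IsSemialgebraic ℚ τ → IsSemialgebraicFunOn ℚ τ a → IsSemialgebraicFunOn ℚ τ b →
      (∀ x ∈ τ, a x ≤ b x) → IsSemialgebraicFunOn ℚ τ h →
      IsSemialgebraicFunOn ℚ {z | (Fin.init z : Fin n → ℝ) ∈ τ ∧ a (Fin.init z) ≤ z (Fin.last n) ∧
        z (Fin.last n) ≤ b (Fin.init z)} V →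
      (∀ z ∈ {z | (Fin.init z : Fin n → ℝ) ∈ τ ∧ a (Fin.init z) ≤ z (Fin.last n) ∧
        z (Fin.last n) ≤ b (Fin.init z)}, 0 < V z) →
      (∀ x ∈ τ, ContinuousOn (fun t : ℝ => V (Fin.snoc x t)) (Set.Icc (a x) (b x))) →
      (∀ x ∈ τ, ∀ t ∈ Set.Ioo (a x) (b x),
        HasDerivAt (fun s : ℝ => V (Fin.snoc x s)) (V' (Fin.snoc x t)) t) →
      IntegrableOn (fun z => h (Fin.init z) * V' z / V z)
        {z | (Fin.init z : Fin n → ℝ) ∈ τ ∧ a (Fin.init z) ≤ z (Fin.last n) ∧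
          z (Fin.last n) ≤ b (Fin.init z)} →
      ∃ m : (Fin n → ℝ) → ℝ, IsSemialgebraicFunOn ℚ τ m ∧ (∀ x ∈ τ, 0 < m x) ∧
        (∀ x ∈ τ, ∀ t ∈ Set.Icc (a x) (b x), m x ≤ V (Fin.snoc x t)) ∧
        IntegrableOn (fun x => h x * Real.log (V (Fin.snoc x (b x)) / m x)) τ ∧
        IntegrableOn (fun x => h x * Real.log (V (Fin.snoc x (a x)) / m x)) τ := by
  sorry

/-- **T2, transfer**: min-normalisation and boundary rigidity imply the crux (expanded verbatim;
`Negative.crux_iff` is `Iff.rfl`). Renormalise `Ṽᵢ = Vᵢ / mᵢ ≥ 1` (same band integrand `Vᵢ'/Vᵢ`,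
`r'.integrand = Σ hᵢ (log Ṽᵢ(·,b) − log Ṽᵢ(·,a))`), replace `Vᵢ'` by its `ℚ`-semialgebraic version
(`IsSemialgebraicFunOn.hasDerivAt_last_isSemialgebraic_holds`, graphs of `a, b` null), run the tree
engine `KZ.unfoldedLogStokes_mem_relations` once per `i` with `H = hᵢ ∘ Fin.init`, `H' = 0`, sum, and
feed the `2k` endpoint monomials (`W = (Ṽ(·,b), Ṽ(·,a))`, coefficients `(h, −h)`, `g = r'`) to
`Negative.BoundaryRigidity`. -/
theorem stub_transfer :
    (∀ (n : ℕ) (τ : Set (Fin n → ℝ)) (a b : (Fin n → ℝ) → ℝ) (h : (Fin n → ℝ) → ℝ)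
      (V V' : (Fin (n + 1) → ℝ) → ℝ),
      IsSemialgebraic ℚ τ → IsSemialgebraicFunOn ℚ τ a → IsSemialgebraicFunOn ℚ τ b →
      (∀ x ∈ τ, a x ≤ b x) → IsSemialgebraicFunOn ℚ τ h →
      IsSemialgebraicFunOn ℚ {z | (Fin.init z : Fin n → ℝ) ∈ τ ∧ a (Fin.init z) ≤ z (Fin.last n) ∧
        z (Fin.last n) ≤ b (Fin.init z)} V →
      (∀ z ∈ {z | (Fin.init z : Fin n → ℝ) ∈ τ ∧ a (Fin.init z) ≤ z (Fin.last n) ∧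
        z (Fin.last n) ≤ b (Fin.init z)}, 0 < V z) →
      (∀ x ∈ τ, ContinuousOn (fun t : ℝ => V (Fin.snoc x t)) (Set.Icc (a x) (b x))) →
      (∀ x ∈ τ, ∀ t ∈ Set.Ioo (a x) (b x),
        HasDerivAt (fun s : ℝ => V (Fin.snoc x s)) (V' (Fin.snoc x t)) t) →
      IntegrableOn (fun z => h (Fin.init z) * V' z / V z)
        {z | (Fin.init z : Fin n → ℝ) ∈ τ ∧ a (Fin.init z) ≤ z (Fin.last n) ∧
          z (Fin.last n) ≤ b (Fin.init z)} →
      ∃ m : (Fin n → ℝ) → ℝ, IsSemialgebraicFunOn ℚ τ m ∧ (∀ x ∈ τ, 0 < m x) ∧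
        (∀ x ∈ τ, ∀ t ∈ Set.Icc (a x) (b x), m x ≤ V (Fin.snoc x t)) ∧
        IntegrableOn (fun x => h x * Real.log (V (Fin.snoc x (b x)) / m x)) τ ∧
        IntegrableOn (fun x => h x * Real.log (V (Fin.snoc x (a x)) / m x)) τ) →
    Negative.BoundaryRigidity →
    ∀ (n k : ℕ) (r : KZ.IntegralRep (n + 1)) (r' : KZ.IntegralRep n) (a b : (Fin n → ℝ) → ℝ)
      (h : Fin k → (Fin n → ℝ) → ℝ) (V V' : Fin k → (Fin (n + 1) → ℝ) → ℝ),
      IsSemialgebraicFunOn ℚ r'.domain a → IsSemialgebraicFunOn ℚ r'.domain b →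
      (∀ x ∈ r'.domain, a x ≤ b x) →
      r.domain = {z | (Fin.init z : Fin n → ℝ) ∈ r'.domain ∧ a (Fin.init z) ≤ z (Fin.last n) ∧
        z (Fin.last n) ≤ b (Fin.init z)} →
      (∀ i, IsSemialgebraicFunOn ℚ r'.domain (h i)) →
      (∀ i, IsSemialgebraicFunOn ℚ r.domain (V i)) →
      (∀ i, ∀ z ∈ r.domain, 0 < V i z) →
      (∀ i, ∀ x ∈ r'.domain, ContinuousOn (fun t : ℝ => V i (Fin.snoc x t)) (Set.Icc (a x) (b x))) →
      (∀ i, ∀ x ∈ r'.domain, ∀ t ∈ Set.Ioo (a x) (b x),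
        HasDerivAt (fun s : ℝ => V i (Fin.snoc x s)) (V' i (Fin.snoc x t)) t) →
      (∀ i, IntegrableOn (fun z => h i (Fin.init z) * V' i z / V i z) r.domain) →
      (∀ x ∈ r'.domain, ∀ t ∈ Set.Ioo (a x) (b x),
        r.integrand (Fin.snoc x t) = ∑ i, h i x * V' i (Fin.snoc x t) / V i (Fin.snoc x t)) →
      (∀ x ∈ r'.domain, r'.integrand x =
        ∑ i, h i x * (Real.log (V i (Fin.snoc x (b x))) - Real.log (V i (Fin.snoc x (a x))))) →
      KZ.of r - KZ.of r' ∈ KZ.relations := by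
  sorry

/-- **Cone decomposition** (finite-dimensional, no analysis): for integer vectors `f₁, …, f_R ∈ ℤᵏ`
there are finitely many "simplicial charts" `a`, each with a positive integer `N a`, integer rows
`b a l ∈ ℤᵏ` (`l < p`) and natural exponents `A a i l`, every column `(A a · l)` orthogonal to all
`f_r`, such that every nonnegative real vector `ℓ` orthogonal to all `f_r` lies in some chart:
`b a l · ℓ ≥ 0` for all `l` and `N a · ℓ_i = Σ_l A a i l · (b a l · ℓ)` for all `i`. (Charts =
linearly independent sets of minimal-support nonnegative integer vectors of `ker F`; `b` = `N ×` a
rational left inverse; covering by the conformal/Carathéodory decomposition of `ker F ∩ ℝᵏ_{≥0}`.) -/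
theorem stub_coneDecomposition :
    ∀ (k R : ℕ) (f : Fin R → Fin k → ℤ),
      ∃ (m p : ℕ) (N : Fin m → ℕ) (b : Fin m → Fin p → Fin k → ℤ) (A : Fin m → Fin k → Fin p → ℕ),
        (∀ a, 0 < N a) ∧
        (∀ a l r, ∑ i, f r i * (A a i l : ℤ) = 0) ∧
        ∀ ℓ : Fin k → ℝ, (∀ i, 0 ≤ ℓ i) → (∀ r, ∑ i, (f r i : ℝ) * ℓ i = 0) →
          ∃ a, (∀ l, 0 ≤ ∑ i, (b a l i : ℝ) * ℓ i) ∧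
            ∀ i, (N a : ℝ) * ℓ i = ∑ l, (A a i l : ℝ) * ∑ i', (b a l i' : ℝ) * ℓ i' := by
  sorry

/-- **Cellwise fold** (registered `stub_cellwiseFold`, now fed by `ConeDecomposition`): over a
`ℚ`-semialgebraic `σ` with `W ≥ 1`, given finitely many disjoint open semialgebraic cells covering `σ`
up to a null set, on each of which `h = Σ_r q_r f_r` with `∏ W^{f_r} ≡ 1` and `q_r` semialgebraic, the
unfolded monomials `Uᵢ = [{x ∈ σ, 1 ≤ u ≤ Wᵢ x}, hᵢ x/u]` sum to a relation. On a cell, on the chart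
piece `{x | W^{b a l} ≥ 1 ∀ l, Wᵢ^{N} = ∏_l (W^{b a l})^{A i l} ∀ i}` (semialgebraic, covering by
`ConeDecomposition` applied to `ℓ = log W(x)`): power rule `N[Uᵢ] ∼ [{1 ≤ u ≤ Wᵢ^N}, hᵢ/u]`, product
rule `KZ.of_sub_of_sub_mem_relations_mul` peels the factors `M_l = W^{b a l} ≥ 1` (intermediate
monomials dominated by `N |hᵢ| log Wᵢ`, hence admissible), regrouping by `l` gives integrands
`(Σᵢ A i l hᵢ)/u = 0`; integer division `mem_relations_of_nsmul_mem_relations`; pieces and the null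
remainder by domain additivity. -/
theorem stub_cellwiseFold :
    (∀ (k R : ℕ) (f : Fin R → Fin k → ℤ),
      ∃ (m p : ℕ) (N : Fin m → ℕ) (b : Fin m → Fin p → Fin k → ℤ) (A : Fin m → Fin k → Fin p → ℕ),
        (∀ a, 0 < N a) ∧
        (∀ a l r, ∑ i, f r i * (A a i l : ℤ) = 0) ∧
        ∀ ℓ : Fin k → ℝ, (∀ i, 0 ≤ ℓ i) → (∀ r, ∑ i, (f r i : ℝ) * ℓ i = 0) →
          ∃ a, (∀ l, 0 ≤ ∑ i, (b a l i : ℝ) * ℓ i) ∧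
            ∀ i, (N a : ℝ) * ℓ i = ∑ l, (A a i l : ℝ) * ∑ i', (b a l i' : ℝ) * ℓ i') →
    ∀ (n k : ℕ) (σ : Set (Fin n → ℝ)) (h W : Fin k → (Fin n → ℝ) → ℝ)
      (U : Fin k → KZ.IntegralRep (n + 1)) (N : ℕ) (C : Fin N → Set (Fin n → ℝ)),
      IsSemialgebraic ℚ σ → (∀ i, IsSemialgebraicFunOn ℚ σ (h i)) →
      (∀ i, IsSemialgebraicFunOn ℚ σ (W i)) → (∀ i, ∀ x ∈ σ, 1 ≤ W i x) →
      (∀ i, (U i).domain = {z | (Fin.init z : Fin n → ℝ) ∈ σ ∧ 1 ≤ z (Fin.last n) ∧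
        z (Fin.last n) ≤ W i (Fin.init z)}) →
      (∀ i, EqOn (U i).integrand (fun z => h i (Fin.init z) / z (Fin.last n)) (U i).domain) →
      (∀ i, IntegrableOn (fun x => h i x * Real.log (W i x)) σ) →
      (∀ c, IsSemialgebraic ℚ (C c) ∧ IsOpen (C c) ∧ C c ⊆ σ) →
      Pairwise (Function.onFun Disjoint C) → volume (σ \ ⋃ c, C c) = 0 →
      (∀ c, ∃ (R : ℕ) (f : Fin R → Fin k → ℤ) (q : Fin R → (Fin n → ℝ) → ℝ),
        (∀ r, IsSemialgebraicFunOn ℚ (C c) (q r)) ∧ (∀ r, ∀ x ∈ C c, ∏ i, W i x ^ (f r i) = 1) ∧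
        (∀ i, ∀ x ∈ C c, h i x = ∑ r, q r x * (f r i : ℝ))) →
      ∑ i, KZ.of (U i) ∈ KZ.relations := by
  sorry

/-- **Peeling step** (registered verbatim): one base-derivative of a normalised log-linear relation
`Σ φᵢ log Wᵢ + log P = γ` on an open semialgebraic `U` with differentiable semialgebraic data: the
partials `∂ⱼφᵢ` and the new right-hand side are `ℚ`-semialgebraic on `U` (BPR Prop. 3.22: the graph of
a partial derivative is first-order definable, `isSemialgebraic_setOf_realize_boundedFormula` /
`hasDerivAt_last_isSemialgebraic_holds` after a coordinate permutation), and the differentiated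
identity holds (product rule, `Real.hasDerivAt_log`). -/
theorem stub_peelingStep :
    ∀ (n k : ℕ) (U : Set (Fin n → ℝ)) (φ W : Fin k → (Fin n → ℝ) → ℝ) (P γ : (Fin n → ℝ) → ℝ)
      (j : Fin n), IsSemialgebraic ℚ U → IsOpen U → (∀ i, IsSemialgebraicFunOn ℚ U (φ i)) →
      (∀ i, DifferentiableOn ℝ (φ i) U) → (∀ i, IsSemialgebraicFunOn ℚ U (W i)) →
      (∀ i, DifferentiableOn ℝ (W i) U) → (∀ i, ∀ x ∈ U, 0 < W i x) → IsSemialgebraicFunOn ℚ U P →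
      DifferentiableOn ℝ P U → (∀ x ∈ U, 0 < P x) → IsSemialgebraicFunOn ℚ U γ →
      DifferentiableOn ℝ γ U → (∀ x ∈ U, ∑ i, φ i x * Real.log (W i x) + Real.log (P x) = γ x) →
      (∀ i, IsSemialgebraicFunOn ℚ U (fun x => fderiv ℝ (φ i) x (Pi.single j (1 : ℝ)))) ∧
      IsSemialgebraicFunOn ℚ U (fun x => fderiv ℝ γ x (Pi.single j (1 : ℝ)) -
        ∑ i, φ i x * fderiv ℝ (W i) x (Pi.single j (1 : ℝ)) / W i x -
        fderiv ℝ P x (Pi.single j (1 : ℝ)) / P x) ∧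
      (∀ x ∈ U, ∑ i, fderiv ℝ (φ i) x (Pi.single j (1 : ℝ)) * Real.log (W i x) =
        fderiv ℝ γ x (Pi.single j (1 : ℝ)) -
        ∑ i, φ i x * fderiv ℝ (W i) x (Pi.single j (1 : ℝ)) / W i x -
        fderiv ℝ P x (Pi.single j (1 : ℝ)) / P x) := by
  sorry

/-- **Constant-coefficient rigidity** (registered verbatim): an identity `Σ cᵢ log Wᵢ = G` on an
open `ℚ`-semialgebraic `D` with ALGEBRAIC constants `cᵢ`, continuous positive `ℚ`-semialgebraic `Wᵢ`
and continuous `ℚ`-semialgebraic `G` forces `G ≡ 0` and `c ∈ span_{ℚ̄} {f ∈ ℤᵏ | ∏ Wᵢ^{fᵢ} ≡ 1 on D}`: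
Baker (`baker_holds`) at the RATIONAL points of `D` (values of `ℚ`-semialgebraic functions there are
algebraic), the `ℚ`-free decomposition `c = Σ β_r f_r` making every `∏ Wᵢ^{f_r i}` equal to `1` at
every rational point, density of `ℚⁿ` and continuity. -/
theorem stub_constRigidity :
    ∀ (n k : ℕ) (D : Set (Fin n → ℝ)) (c : Fin k → ℝ) (W : Fin k → (Fin n → ℝ) → ℝ)
      (G : (Fin n → ℝ) → ℝ), IsSemialgebraic ℚ D → IsOpen D → (∀ i, IsAlgebraic ℚ (c i)) →
      (∀ i, IsSemialgebraicFunOn ℚ D (W i)) → (∀ i, ContinuousOn (W i) D) →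
      (∀ i, ∀ x ∈ D, 0 < W i x) → IsSemialgebraicFunOn ℚ D G → ContinuousOn G D →
      (∀ x ∈ D, ∑ i, c i * Real.log (W i x) = G x) →
      (∀ x ∈ D, G x = 0) ∧ ∃ (R : ℕ) (f : Fin R → Fin k → ℤ) (β : Fin R → ℝ),
        (∀ r, IsAlgebraic ℚ (β r)) ∧ (∀ r, ∀ x ∈ D, ∏ i, W i x ^ (f r i) = 1) ∧
        (∀ i, c i = ∑ r, β r * (f r i : ℝ)) := by
  sorry

/-- **Log-linear descent** (registered verbatim, the line's hardest stub, held by the lead): from the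
peeling step and constant-coefficient rigidity, the structure theorem for `ℚ`-semialgebraic
log-linear identities `Σ hᵢ log Wᵢ = g` on a `ℚ`-semialgebraic `U`: finitely many disjoint open
semialgebraic cells covering `U` up to a null set, on each of which `g ≡ 0` and `h = Σ_r q_r f_r`
with `q_r` `ℚ`-semialgebraic and exact multiplicative relations `∏ Wᵢ^{f_r i} ≡ 1` (Kolchin–Ostrowski
induction on `k` along the base: smooth locus, split `{h_k = 0}` / `{h_k ≠ 0}`, divide by the pivot,
differentiate in each `xⱼ` (peeling), induct, integrate the zero gradient back on connected
components modulo the current lattice, const-rigidity for the constant vector, reassemble). -/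
theorem stub_descent :
    (∀ (n k : ℕ) (U : Set (Fin n → ℝ)) (φ W : Fin k → (Fin n → ℝ) → ℝ) (P γ : (Fin n → ℝ) → ℝ)
      (j : Fin n), IsSemialgebraic ℚ U → IsOpen U → (∀ i, IsSemialgebraicFunOn ℚ U (φ i)) →
      (∀ i, DifferentiableOn ℝ (φ i) U) → (∀ i, IsSemialgebraicFunOn ℚ U (W i)) →
      (∀ i, DifferentiableOn ℝ (W i) U) → (∀ i, ∀ x ∈ U, 0 < W i x) → IsSemialgebraicFunOn ℚ U P →
      DifferentiableOn ℝ P U → (∀ x ∈ U, 0 < P x) → IsSemialgebraicFunOn ℚ U γ →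
      DifferentiableOn ℝ γ U → (∀ x ∈ U, ∑ i, φ i x * Real.log (W i x) + Real.log (P x) = γ x) →
      (∀ i, IsSemialgebraicFunOn ℚ U (fun x => fderiv ℝ (φ i) x (Pi.single j (1 : ℝ)))) ∧
      IsSemialgebraicFunOn ℚ U (fun x => fderiv ℝ γ x (Pi.single j (1 : ℝ)) -
        ∑ i, φ i x * fderiv ℝ (W i) x (Pi.single j (1 : ℝ)) / W i x -
        fderiv ℝ P x (Pi.single j (1 : ℝ)) / P x) ∧
      (∀ x ∈ U, ∑ i, fderiv ℝ (φ i) x (Pi.single j (1 : ℝ)) * Real.log (W i x) =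
        fderiv ℝ γ x (Pi.single j (1 : ℝ)) -
        ∑ i, φ i x * fderiv ℝ (W i) x (Pi.single j (1 : ℝ)) / W i x -
        fderiv ℝ P x (Pi.single j (1 : ℝ)) / P x)) →
    (∀ (n k : ℕ) (D : Set (Fin n → ℝ)) (c : Fin k → ℝ) (W : Fin k → (Fin n → ℝ) → ℝ)
      (G : (Fin n → ℝ) → ℝ), IsSemialgebraic ℚ D → IsOpen D → (∀ i, IsAlgebraic ℚ (c i)) →
      (∀ i, IsSemialgebraicFunOn ℚ D (W i)) → (∀ i, ContinuousOn (W i) D) →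
      (∀ i, ∀ x ∈ D, 0 < W i x) → IsSemialgebraicFunOn ℚ D G → ContinuousOn G D →
      (∀ x ∈ D, ∑ i, c i * Real.log (W i x) = G x) →
      (∀ x ∈ D, G x = 0) ∧ ∃ (R : ℕ) (f : Fin R → Fin k → ℤ) (β : Fin R → ℝ),
        (∀ r, IsAlgebraic ℚ (β r)) ∧ (∀ r, ∀ x ∈ D, ∏ i, W i x ^ (f r i) = 1) ∧
        (∀ i, c i = ∑ r, β r * (f r i : ℝ))) →
    ∀ (n k : ℕ) (U : Set (Fin n → ℝ)) (h W : Fin k → (Fin n → ℝ) → ℝ) (g : (Fin n → ℝ) → ℝ),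
      IsSemialgebraic ℚ U → (∀ i, IsSemialgebraicFunOn ℚ U (h i)) →
      (∀ i, IsSemialgebraicFunOn ℚ U (W i)) → (∀ i, ∀ x ∈ U, 0 < W i x) →
      IsSemialgebraicFunOn ℚ U g → (∀ x ∈ U, ∑ i, h i x * Real.log (W i x) = g x) →
      ∃ (N : ℕ) (C : Fin N → Set (Fin n → ℝ)),
        (∀ c, IsSemialgebraic ℚ (C c) ∧ IsOpen (C c) ∧ C c ⊆ U) ∧
        Pairwise (Function.onFun Disjoint C) ∧ volume (U \ ⋃ c, C c) = 0 ∧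
        ∀ c, (∀ x ∈ C c, g x = 0) ∧
          ∃ (R : ℕ) (f : Fin R → Fin k → ℤ) (q : Fin R → (Fin n → ℝ) → ℝ),
            (∀ r, IsSemialgebraicFunOn ℚ (C c) (q r)) ∧
            (∀ r, ∀ x ∈ C c, ∏ i, W i x ^ (f r i) = 1) ∧
            (∀ i, ∀ x ∈ C c, h i x = ∑ r, q r x * (f r i : ℝ)) := by
  sorry

/-! ## Glue (sorry-free) -/

/-- A representation whose integrand vanishes on its domain off a null `ℚ`-semialgebraic subset is a
relation (domain additivity + `KZ.of_mem_relations_of_eqOn_zero` + `KZ.of_mem_relations_of_volume_eq_zero`). -/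
theorem of_mem_relations_of_eqOn_zero_off_null {n : ℕ} (g : KZ.IntegralRep n)
    (A : Set (Fin n → ℝ)) (hA : IsSemialgebraic ℚ A) (hAg : A ⊆ g.domain)
    (hnull : volume (g.domain \ A) = 0) (hzero : ∀ x ∈ A, g.integrand x = 0) :
    KZ.of g ∈ KZ.relations := by
  have hB : IsSemialgebraic ℚ (g.domain \ A) := g.isSemialgebraic_domain.diff hA
  set gA := g.restrict A hA hAg with hgA
  set gB := g.restrict (g.domain \ A) hB sdiff_subset with hgB
  have hsplit : KZ.of g - KZ.of gA - KZ.of gB ∈ KZ.relations := by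
    refine KZ.domainAddRel_subset_relations ⟨n, g, gA, gB, ?_, ?_, fun _ _ => rfl, fun _ _ => rfl,
      rfl⟩
    · simp only [hgA, hgB, KZ.IntegralRep.domain_restrict, union_sdiff_self]
      exact (union_eq_self_of_subset_left hAg).symm
    · simp only [hgA, hgB, KZ.IntegralRep.domain_restrict, inter_sdiff_self, measure_empty]
  have h1 : KZ.of gA ∈ KZ.relations :=
    KZ.of_mem_relations_of_eqOn_zero gA fun x hx => by simpa [hgA] using hzero x hx
  have h2 : KZ.of gB ∈ KZ.relations := KZ.of_mem_relations_of_volume_eq_zero gB hnull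
  have : KZ.of g = (KZ.of g - KZ.of gA - KZ.of gB) + KZ.of gA + KZ.of gB := by abel
  rw [this]
  exact KZ.relations.add_mem (KZ.relations.add_mem hsplit h1) h2

/-- **Descent + fold ⇒ boundary rigidity.** The descent (applied to `g.integrand = Σ hᵢ log Wᵢ` on
`g.domain`) gives cells on which `g.integrand = 0` — so `[g]` is a relation
(`of_mem_relations_of_eqOn_zero_off_null`) — and the lattice structure that the cellwise fold turns
into `Σ [Uᵢ] ∈ relations`. -/
theorem boundaryRigidity_of_stubs : Negative.BoundaryRigidity := by
  intro n k g h W U hh hW hW1 hUd hUi hUint hg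
  have hσ : IsSemialgebraic ℚ g.domain := g.isSemialgebraic_domain
  have hWpos : ∀ i, ∀ x ∈ g.domain, 0 < W i x := fun i x hx => one_pos.trans_le (hW1 i x hx)
  obtain ⟨N, C, hC, hdisj, hnull, hcell⟩ :=
    stub_descent stub_peelingStep stub_constRigidity n k g.domain h W g.integrand hσ hh hW hWpos
      g.isSemialgebraicFunOn_integrand (fun x hx => (hg x hx).symm)
  have hfold : ∑ i, KZ.of (U i) ∈ KZ.relations :=
    stub_cellwiseFold stub_coneDecomposition n k g.domain h W U N C hσ hh hW hW1 hUd hUi hUint hC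
      hdisj hnull (fun c => (hcell c).2)
  have hA : IsSemialgebraic ℚ (⋃ c, C c) := by
    have : (⋃ c, C c) = ⋃ c ∈ (Finset.univ : Finset (Fin N)), C c := by simp
    rw [this]
    exact IsSemialgebraic.biUnion _ _ fun c _ => (hC c).1
  have hg0 : KZ.of g ∈ KZ.relations := by
    refine of_mem_relations_of_eqOn_zero_off_null g (⋃ c, C c) hA
      (iUnion_subset fun c => (hC c).2.2) hnull fun x hx => ?_
    obtain ⟨c, hxc⟩ := mem_iUnion.1 hx
    exact (hcell c).1 x hxc
  exact KZ.relations.sub_mem hfold hg0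

/-- **The composition**: the crux `LogPrimitiveNL`, BY NAME, from the stubs. -/
theorem LogPrimitiveNL_of : LogPrimitiveNL :=
  fun n k r r' a b h V V' =>
    stub_transfer stub_minNormalisation boundaryRigidity_of_stubs n k r r' a b h V V'

end Summit.KontsevichZagierPeriods.LiouvilleUnfolding.LogPrimitiveNL

end
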